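import Summits.AtomisticToContinuum.FouriersLaw.Theorems.BondHeatUncertaintyBoundedResponseParityFloorProof
import Summits.AtomisticToContinuum.FouriersLaw.Theorems.BondHeatUncertaintyBoundedResponseSnapshotKLProof
import HarnessLib

/-!
# The door of record for `BoundedResponse` (stmt-AtomisticToContinuum-11071) after generation 95: `(D) ∧ (K)`

Decomposition cell `decomp-a2c`, lens «grading / quantitative ladder», generation 95.  One-line assembly of the two
sibling files of this generation (to be landed AFTER both):

* `…BondHeatUncertaintyBoundedResponseParityFloorProof.lean` — `overshootParityFloor_holds : OvershootParityFloor` ((L));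
* `…BondHeatUncertaintyBoundedResponseSnapshotKLProof.lean` — `snapshotKLLowerExpansion_holds : SnapshotKLLowerExpansion`
  ((L₂)) and the seam `boundedResponse_of_deficitCesaroPoint_parityFloor : (D) → (L) → (K) → BoundedResponse`.

Hence **`BoundedResponse ⟸ DeficitCesaroPoint ∧ ExtensiveSnapshotIrreversibility`**: the residual (D) and the route's
crux (K) = stmt-AtomisticToContinuum-9121 verbatim, consumed linearly `(K) ⟹ (O₁) ⟹ TransientFloor 1`.
No `sorry`, no new axioms, restates nothing. [folklore]
-/

namespace Summit.AtomisticToContinuum.FouriersLaw.Theorems.BoundedResponse.ParityFloor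

open Summit.AtomisticToContinuum.FouriersLaw.Theses.BondHeatUncertainty (BoundedResponse ExtensiveSnapshotIrreversibility)
open Summit.AtomisticToContinuum.FouriersLaw.Theorems.SubdiffusiveBondHeat.EscapeGrading (OhmicFloor)
open Summit.AtomisticToContinuum.FouriersLaw.Theorems.BoundedResponse.TransientBand (DeficitCesaroPoint TransientFloor)

/-- **`(K) ⟹ TransientFloor 1`** — both fixed-`N` pieces (L), (L₂) discharged. [folklore] -/
theorem transientFloor_one_of_extensiveSnapshot : ExtensiveSnapshotIrreversibility → TransientFloor 1 :=
  transientFloor_one_of_parityFloor_extensiveSnapshot overshootParityFloor_holds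

/-- **THE DOOR OF RECORD (generation 95): `(D) ∧ (K) ⟹ BoundedResponse` (stmt-AtomisticToContinuum-11071) BY NAME.** [folklore] -/
theorem boundedResponse_of_deficitCesaroPoint_extensiveSnapshot :
    DeficitCesaroPoint → ExtensiveSnapshotIrreversibility → BoundedResponse :=
  fun hD => boundedResponse_of_deficitCesaroPoint_parityFloor hD overshootParityFloor_holds

/-- The same door in the escape-exponent language: `(D) ∧ (K) ⟹ OhmicFloor`. [folklore] -/
theorem ohmicFloor_of_deficitCesaroPoint_extensiveSnapshot :
    DeficitCesaroPoint → ExtensiveSnapshotIrreversibility → OhmicFloor :=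
  fun hD => ohmicFloor_of_deficitCesaroPoint_parityFloor hD overshootParityFloor_holds

end Summit.AtomisticToContinuum.FouriersLaw.Theorems.BoundedResponse.ParityFloor
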